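import Mathlib.Topology.ContinuousMap.Compact
import Literature.Analysis.UnboundedOperators.SemilinearMildTubeLipschitz
import Literature.Analysis.UnboundedOperators.SemilinearMildTubeShift
import HarnessLib

/-!
# Mild solutions as continuous curves on compact intervals: uniqueness, restriction, shift, concatenation

Analysis/UnboundedOperators support file (everything proved; no definitions, no named facts).  Let `E` be
a real Banach space, `T(t)` (`t ≥ 0`) bounded operators, `K(t)` (`t > 0`) bounded operators strongly
continuous on `(0, ∞)` with the weakly singular bound `‖K(t)‖ ≤ C t^{−α}` (`α < 1`), `N` a bounded
bilinear map and `f ∈ E` a constant forcing.  A continuous curve `z ∈ C([0, t]; E)` is a *mild solution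
from `x` on `[0, t]`* when

  `z(r) = T(r) x + ∫₀ʳ T(r − s) f ds − ∫₀ʳ K(r − s) N(z(s), z(s)) ds`   (`0 ≤ r ≤ t`),

the curve being read on `ℝ` through the retraction `Set.projIcc 0 t` inside the integral (the form used
by the local smooth flow `exists_smoothMildFlow` and the tube theorem `exists_mildTube` of this
directory).  This file packages the bookkeeping of such curves needed to define a semiflow by "the value
at time `t` of the mild solution on `[0, t]`" (D. Henry, *Geometric Theory of Semilinear Parabolic
Equations*, LNM 840 (1981), Thm. 3.3.3 (uniqueness), Thm. 3.3.4 (continuation); A. Pazy, *Semigroups of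
Linear Operators and Applications to PDE* (1983), §6.3, Thm. 6.3.1):

* `mild_apply_zero`, `mild_const` — a mild solution starts at `x`; the constant curve is the mild
  solution on the degenerate interval `[0, 0]`;
* `mild_unique` — two continuous mild solutions from the same datum on `[0, t]` coincide (contractions
  `T`; Lipschitz stability `exists_forall_norm_sub_le_of_mild` with equal data);
* `exists_mild_restrict` — restriction to `[0, t']`, `t' ≤ t`;
* `exists_mild_shift` — the shift `r ↦ z(t + r)` of a mild solution on `[0, s + t]` is a mild solution
  on `[0, s]` from `z(t)` (`duhamel_shift`);
* `exists_mild_concat` — a mild solution on `[0, t]` from `x` continued by a mild solution on `[0, s]`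
  from `z(t)` glue to a continuous mild solution on `[0, s + t]` from `x` (`duhamel_concat`).

Deliberately NOT here: existence, maximal solutions, dependence on the data.

## References

* D. Henry, *Geometric Theory of Semilinear Parabolic Equations*, LNM 840, Springer (1981), Thm. 3.3.3,
  Thm. 3.3.4. [Henry1981]
* A. Pazy, *Semigroups of Linear Operators and Applications to Partial Differential Equations*, Springer
  (1983), §6.3, Thm. 6.3.1. [Pazy1983]
-/

noncomputable section

open Set Filter MeasureTheory intervalIntegral
open _root_.Topology

namespace Literature.Analysis.UnboundedOperators

variable {E : Type*} [NormedAddCommGroup E] [NormedSpace ℝ E]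

/-- **A mild solution starts at its datum**: evaluating the mild identity at `r = 0` (both integrals
over `[0, 0]` vanish, `T(0) = 1`) gives `z(0) = x`. [folklore] -/
theorem mild_apply_zero (T K : ℝ → E →L[ℝ] E) (hT0 : T 0 = 1) (N : E →L[ℝ] E →L[ℝ] E) (f : E)
    {t : ℝ} (ht : 0 ≤ t) {x : E} {z : C(Icc (0 : ℝ) t, E)}
    (hz : ∀ r : Icc (0 : ℝ) t, z r = T r x + (∫ s in (0 : ℝ)..(r : ℝ), T ((r : ℝ) - s) f) -
      ∫ s in (0 : ℝ)..(r : ℝ), K ((r : ℝ) - s) (N (z (projIcc 0 t ht s)) (z (projIcc 0 t ht s)))) :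
    z ⟨0, left_mem_Icc.2 ht⟩ = x := by
  have h := hz ⟨0, left_mem_Icc.2 ht⟩
  simp only [intervalIntegral.integral_same, add_zero, sub_zero, hT0, one_apply_eq_self] at h
  exact h

/-- **The constant curve is the mild solution on the degenerate interval `[0, 0]`.** [folklore] -/
theorem mild_const (T K : ℝ → E →L[ℝ] E) (hT0 : T 0 = 1) (N : E →L[ℝ] E →L[ℝ] E) (f x : E) :
    ∀ r : Icc (0 : ℝ) 0, ContinuousMap.const (Icc (0 : ℝ) 0) x r = T r x +
      (∫ s in (0 : ℝ)..(r : ℝ), T ((r : ℝ) - s) f) - ∫ s in (0 : ℝ)..(r : ℝ), K ((r : ℝ) - s)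
        (N (ContinuousMap.const (Icc (0 : ℝ) 0) x (projIcc 0 0 le_rfl s))
          (ContinuousMap.const (Icc (0 : ℝ) 0) x (projIcc 0 0 le_rfl s))) := by
  intro r
  have hr : (r : ℝ) = 0 := le_antisymm r.2.2 r.2.1
  simp only [hr, intervalIntegral.integral_same, add_zero, sub_zero, hT0, one_apply_eq_self,
    ContinuousMap.const_apply]

/-- **Uniqueness of continuous mild solutions** (Henry 1981, Thm. 3.3.3; Pazy 1983, Thm. 6.3.1): for
contractions `T(t)`, a weakly singular strongly continuous family `K` and a bounded bilinear `N`, two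
continuous mild solutions on `[0, t]` from the same datum coincide — the Lipschitz stability estimate
`exists_forall_norm_sub_le_of_mild` with equal data (both curves are bounded on the compact interval).
[cite: Henry1981, Thm 3.3.3] -/
theorem mild_unique (T K : ℝ → E →L[ℝ] E) (hTnorm : ∀ t, 0 ≤ t → ‖T t‖ ≤ 1) {α C : ℝ} (hα : α < 1)
    (hC : 0 ≤ C) (hK : ∀ t, 0 < t → ‖K t‖ ≤ C * t ^ (-α))
    (hKc : ∀ y : E, ContinuousOn (fun t : ℝ => K t y) (Ioi 0)) (N : E →L[ℝ] E →L[ℝ] E) (f : E)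
    {t : ℝ} (ht : 0 ≤ t) {x : E} {z₁ z₂ : C(Icc (0 : ℝ) t, E)}
    (h₁ : ∀ r : Icc (0 : ℝ) t, z₁ r = T r x + (∫ s in (0 : ℝ)..(r : ℝ), T ((r : ℝ) - s) f) -
      ∫ s in (0 : ℝ)..(r : ℝ), K ((r : ℝ) - s) (N (z₁ (projIcc 0 t ht s)) (z₁ (projIcc 0 t ht s))))
    (h₂ : ∀ r : Icc (0 : ℝ) t, z₂ r = T r x + (∫ s in (0 : ℝ)..(r : ℝ), T ((r : ℝ) - s) f) -
      ∫ s in (0 : ℝ)..(r : ℝ), K ((r : ℝ) - s) (N (z₂ (projIcc 0 t ht s)) (z₂ (projIcc 0 t ht s)))) :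
    z₁ = z₂ := by
  obtain ⟨Lip, -, hLip⟩ :=
    exists_forall_norm_sub_le_of_mild T K hTnorm hα hC hK hKc N f (‖z₁‖ + ‖z₂‖) t
  have hc : ∀ z : C(Icc (0 : ℝ) t, E), Continuous fun s => z (projIcc 0 t ht s) := fun z =>
    z.continuous.comp continuous_projIcc
  have hm : ∀ z : C(Icc (0 : ℝ) t, E), (∀ r : Icc (0 : ℝ) t, z r = T r x +
      (∫ s in (0 : ℝ)..(r : ℝ), T ((r : ℝ) - s) f) - ∫ s in (0 : ℝ)..(r : ℝ), K ((r : ℝ) - s)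
        (N (z (projIcc 0 t ht s)) (z (projIcc 0 t ht s)))) →
      ∀ r ∈ Icc 0 t, z (projIcc 0 t ht r) = T r x + (∫ s in (0 : ℝ)..r, T (r - s) f) -
        ∫ s in (0 : ℝ)..r, K (r - s) (N (z (projIcc 0 t ht s)) (z (projIcc 0 t ht s))) := by
    intro z hz r hr
    rw [projIcc_of_mem ht hr]
    exact hz ⟨r, hr⟩
  have hb : ∀ z : C(Icc (0 : ℝ) t, E), ∀ r ∈ Icc 0 t, ‖z (projIcc 0 t ht r)‖ ≤ ‖z‖ := fun z r _ =>
    z.norm_coe_le_norm _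
  have h := hLip t le_rfl _ _ x x (hc z₁) (hc z₂) (hm z₁ h₁) (hm z₂ h₂)
    (fun r hr => (hb z₁ r hr).trans (le_add_of_nonneg_right (norm_nonneg _)))
    (fun r hr => (hb z₂ r hr).trans (le_add_of_nonneg_left (norm_nonneg _)))
  ext r
  have hr := h r r.2
  rw [sub_self, norm_zero, mul_zero, norm_le_zero_iff, sub_eq_zero, projIcc_val ht r] at hr
  exact hr

/-- **Restriction of a mild solution to a smaller interval** `[0, t'] ⊆ [0, t]`: the same identity with
the same integrands. [folklore] -/
theorem exists_mild_restrict (T K : ℝ → E →L[ℝ] E) (N : E →L[ℝ] E →L[ℝ] E) (f : E) {t t' : ℝ}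
    (ht : 0 ≤ t) (ht' : 0 ≤ t') (htt' : t' ≤ t) {x : E} {z : C(Icc (0 : ℝ) t, E)}
    (hz : ∀ r : Icc (0 : ℝ) t, z r = T r x + (∫ s in (0 : ℝ)..(r : ℝ), T ((r : ℝ) - s) f) -
      ∫ s in (0 : ℝ)..(r : ℝ), K ((r : ℝ) - s) (N (z (projIcc 0 t ht s)) (z (projIcc 0 t ht s)))) :
    ∃ z' : C(Icc (0 : ℝ) t', E),
      (∀ r : Icc (0 : ℝ) t', z' r = T r x + (∫ s in (0 : ℝ)..(r : ℝ), T ((r : ℝ) - s) f) -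
        ∫ s in (0 : ℝ)..(r : ℝ), K ((r : ℝ) - s)
          (N (z' (projIcc 0 t' ht' s)) (z' (projIcc 0 t' ht' s)))) ∧
      ∀ r : Icc (0 : ℝ) t', z' r = z ⟨r, r.2.1, r.2.2.trans htt'⟩ := by
  refine ⟨⟨fun r => z ⟨r, r.2.1, r.2.2.trans htt'⟩,
    z.continuous.comp (continuous_inclusion (Icc_subset_Icc_right htt'))⟩, fun r => ?_, fun r => rfl⟩
  have hr : (r : ℝ) ∈ Icc 0 t := ⟨r.2.1, r.2.2.trans htt'⟩
  rw [ContinuousMap.coe_mk, hz ⟨r, hr⟩]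
  congr 1
  refine intervalIntegral.integral_congr fun s hs => ?_
  rw [uIcc_of_le r.2.1] at hs
  have hs' : s ∈ Icc 0 t' := ⟨hs.1, hs.2.trans r.2.2⟩
  simp only [projIcc_of_mem ht' hs', projIcc_of_mem ht (Icc_subset_Icc_right htt' hs')]

variable [CompleteSpace E]

/-- **Shift of a mild solution** (Henry 1981, §3.3; Pazy 1983, §6.3): if `z` is a continuous mild
solution from `x` on `[0, τ]`, `τ = s + t` with `s, t ≥ 0`, then `r ↦ z(t + r)` is a continuous mild
solution on `[0, s]` from `z(t)` — `duhamel_shift` read for curves on compact intervals (semigroup `T`,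
intertwining `K(a + b) = T(a) K(b)`). [folklore] -/
theorem exists_mild_shift (T K : ℝ → E →L[ℝ] E) {α C : ℝ} (hα : α < 1)
    (hTadd : ∀ s t, 0 ≤ s → 0 ≤ t → T (s + t) = (T s).comp (T t))
    (hTc : ∀ y : E, Continuous fun t : ℝ => T t y) (hK : ∀ t, 0 < t → ‖K t‖ ≤ C * t ^ (-α))
    (hKadd : ∀ s t, 0 ≤ s → 0 < t → K (s + t) = (T s).comp (K t))
    (hKc : ∀ y : E, ContinuousOn (fun t : ℝ => K t y) (Ioi 0)) (N : E →L[ℝ] E →L[ℝ] E) (f : E)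
    {t s τ : ℝ} (ht : 0 ≤ t) (hs : 0 ≤ s) (hτ0 : 0 ≤ τ) (hτ : s + t = τ) {x : E}
    {z : C(Icc (0 : ℝ) τ, E)}
    (hz : ∀ r : Icc (0 : ℝ) τ, z r = T r x + (∫ σ in (0 : ℝ)..(r : ℝ), T ((r : ℝ) - σ) f) -
      ∫ σ in (0 : ℝ)..(r : ℝ), K ((r : ℝ) - σ) (N (z (projIcc 0 τ hτ0 σ)) (z (projIcc 0 τ hτ0 σ)))) :
    ∃ w : C(Icc (0 : ℝ) s, E),
      (∀ r : Icc (0 : ℝ) s, w r = T r (z ⟨t, ht, (le_add_of_nonneg_left hs).trans_eq hτ⟩) +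
        (∫ σ in (0 : ℝ)..(r : ℝ), T ((r : ℝ) - σ) f) - ∫ σ in (0 : ℝ)..(r : ℝ), K ((r : ℝ) - σ)
          (N (w (projIcc 0 s hs σ)) (w (projIcc 0 s hs σ)))) ∧
      ∀ r : Icc (0 : ℝ) s, w r = z (projIcc 0 τ hτ0 (t + r)) := by
  have htτ : t ≤ τ := (le_add_of_nonneg_left hs).trans_eq hτ
  set u : ℝ → E := fun r => z (projIcc 0 τ hτ0 r) with hu
  have huc : Continuous u := z.continuous.comp continuous_projIcc
  have hG : Continuous fun σ => N (u σ) (u σ) := (N.continuous.comp huc).clm_apply huc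
  have hU : ∀ r ∈ Icc 0 τ, u r = T r x + (∫ σ in (0 : ℝ)..r, T (r - σ) f) -
      ∫ σ in (0 : ℝ)..r, K (r - σ) (N (u σ) (u σ)) := by
    intro r hr
    simp only [hu, projIcc_of_mem hτ0 hr]
    exact hz ⟨r, hr⟩
  have hshift := duhamel_shift hα hTadd hTc hK hKadd hKc f hG ht htτ hU
  refine ⟨⟨fun r => u (t + r), huc.comp (continuous_const.add continuous_subtype_val)⟩,
    fun r => ?_, fun r => rfl⟩
  have hr : (r : ℝ) ∈ Icc 0 (τ - t) := ⟨r.2.1, by linarith [r.2.2]⟩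
  rw [ContinuousMap.coe_mk, hshift r hr, hu]
  simp only [projIcc_of_mem hτ0 ⟨ht, htτ⟩]
  congr 1
  refine intervalIntegral.integral_congr fun σ hσ => ?_
  rw [uIcc_of_le r.2.1] at hσ
  simp only [projIcc_of_mem hs ⟨hσ.1, hσ.2.trans r.2.2⟩]

/-- **Concatenation of mild solutions** (Henry 1981, Thm. 3.3.4; Pazy 1983, Thm. 6.3.1, continuation
step): a continuous mild solution `z` from `x` on `[0, t]` followed by a continuous mild solution `w` from
`z(t)` on `[0, s]` glue (`w(0) = z(t)`) to a continuous mild solution on `[0, τ]`, `τ = s + t`, from `x`,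
equal to `z` on `[0, t]` and to `w(· − t)` on `[t, τ]` — `duhamel_concat` read for curves on compact
intervals. [folklore] -/
theorem exists_mild_concat (T K : ℝ → E →L[ℝ] E) (hT0 : T 0 = 1) {α C : ℝ} (hα : α < 1)
    (hTadd : ∀ s t, 0 ≤ s → 0 ≤ t → T (s + t) = (T s).comp (T t))
    (hTc : ∀ y : E, Continuous fun t : ℝ => T t y) (hK : ∀ t, 0 < t → ‖K t‖ ≤ C * t ^ (-α))
    (hKadd : ∀ s t, 0 ≤ s → 0 < t → K (s + t) = (T s).comp (K t))
    (hKc : ∀ y : E, ContinuousOn (fun t : ℝ => K t y) (Ioi 0)) (N : E →L[ℝ] E →L[ℝ] E) (f : E)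
    {t s τ : ℝ} (ht : 0 ≤ t) (hs : 0 ≤ s) (hτ0 : 0 ≤ τ) (hτ : s + t = τ) {x : E}
    {z : C(Icc (0 : ℝ) t, E)} {w : C(Icc (0 : ℝ) s, E)}
    (hz : ∀ r : Icc (0 : ℝ) t, z r = T r x + (∫ σ in (0 : ℝ)..(r : ℝ), T ((r : ℝ) - σ) f) -
      ∫ σ in (0 : ℝ)..(r : ℝ), K ((r : ℝ) - σ) (N (z (projIcc 0 t ht σ)) (z (projIcc 0 t ht σ))))
    (hw : ∀ r : Icc (0 : ℝ) s, w r = T r (z ⟨t, right_mem_Icc.2 ht⟩) +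
      (∫ σ in (0 : ℝ)..(r : ℝ), T ((r : ℝ) - σ) f) - ∫ σ in (0 : ℝ)..(r : ℝ), K ((r : ℝ) - σ)
        (N (w (projIcc 0 s hs σ)) (w (projIcc 0 s hs σ)))) :
    ∃ Z : C(Icc (0 : ℝ) τ, E),
      (∀ r : Icc (0 : ℝ) τ, Z r = T r x + (∫ σ in (0 : ℝ)..(r : ℝ), T ((r : ℝ) - σ) f) -
        ∫ σ in (0 : ℝ)..(r : ℝ), K ((r : ℝ) - σ)
          (N (Z (projIcc 0 τ hτ0 σ)) (Z (projIcc 0 τ hτ0 σ)))) ∧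
      (∀ r : Icc (0 : ℝ) τ, (r : ℝ) ≤ t → Z r = z (projIcc 0 t ht r)) ∧
      (∀ r : Icc (0 : ℝ) τ, t ≤ (r : ℝ) → Z r = w (projIcc 0 s hs ((r : ℝ) - t))) := by
  have htτ : t ≤ τ := (le_add_of_nonneg_left hs).trans_eq hτ
  -- the glued curve on `ℝ` and its continuity (the two branches agree at `r = t`: `w 0 = z t`)
  set Zf : ℝ → E := fun r => if r ≤ t then z (projIcc 0 t ht r) else w (projIcc 0 s hs (r - t))
    with hZf
  have hw0 : w ⟨0, left_mem_Icc.2 hs⟩ = z ⟨t, right_mem_Icc.2 ht⟩ := mild_apply_zero T K hT0 N f hs hw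
  have hJ0 : ∀ r, r ≤ t → Zf r = z (projIcc 0 t ht r) := fun r hr => if_pos hr
  have hJ1 : ∀ r, t ≤ r → Zf r = w (projIcc 0 s hs (r - t)) := by
    intro r hr
    rcases hr.eq_or_lt with rfl | hlt
    · rw [hJ0 t le_rfl, sub_self, projIcc_left, projIcc_right, hw0]
    · exact if_neg (not_le.2 hlt)
  have hZc : Continuous Zf :=
    Continuous.if_le (z.continuous.comp continuous_projIcc)
      ((w.continuous.comp continuous_projIcc).comp (continuous_id.sub continuous_const))
      continuous_id continuous_const fun r hr => by
        rw [hr, sub_self, projIcc_left, projIcc_right, hw0]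
  have hG : Continuous fun σ => N (Zf σ) (Zf σ) := (N.continuous.comp hZc).clm_apply hZc
  -- the two Duhamel identities
  have h1 : ∀ r ∈ Icc 0 t, Zf r = T r x + (∫ σ in (0 : ℝ)..r, T (r - σ) f) -
      ∫ σ in (0 : ℝ)..r, K (r - σ) (N (Zf σ) (Zf σ)) := by
    intro r hr
    rw [hJ0 r hr.2, projIcc_of_mem ht hr, hz ⟨r, hr⟩]
    congr 1
    refine intervalIntegral.integral_congr fun σ hσ => ?_
    rw [uIcc_of_le hr.1] at hσ
    simp only [hJ0 σ (hσ.2.trans hr.2)]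
  have h2 : ∀ r ∈ Icc t τ, Zf r = T (r - t) (Zf t) + (∫ σ in (0 : ℝ)..(r - t), T (r - t - σ) f) -
      ∫ σ in (0 : ℝ)..(r - t), K (r - t - σ) (N (Zf (t + σ)) (Zf (t + σ))) := by
    intro r hr
    have hr' : r - t ∈ Icc 0 s := ⟨sub_nonneg.2 hr.1, by linarith [hr.2]⟩
    rw [hJ1 r hr.1, hJ0 t le_rfl, projIcc_of_mem hs hr', projIcc_right, hw ⟨r - t, hr'⟩]
    congr 1
    refine intervalIntegral.integral_congr fun σ hσ => ?_
    rw [uIcc_of_le hr'.1] at hσ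
    simp only [hJ1 (t + σ) (le_add_of_nonneg_right hσ.1), add_sub_cancel_left]
  have hmild := duhamel_concat hα hTadd hTc hK hKadd hKc f hG ht h1 h2
  refine ⟨⟨fun r => Zf r, hZc.comp continuous_subtype_val⟩, fun r => ?_, fun r hr => hJ0 r hr,
    fun r hr => hJ1 r hr⟩
  rw [ContinuousMap.coe_mk, hmild r ⟨r.2.1, r.2.2⟩]
  congr 1
  refine intervalIntegral.integral_congr fun σ hσ => ?_
  rw [uIcc_of_le r.2.1] at hσ
  simp only [projIcc_of_mem hτ0 ⟨hσ.1, hσ.2.trans r.2.2⟩]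

end Literature.Analysis.UnboundedOperators

end
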